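import Summits.ABC.StewartYu.PadicTwistMain
import Summits.ABC.StewartYu.PadicTwistPMHalfValues
import Summits.ABC.StewartYu.PadicCW77HalfStep
import HarnessLib

/-!
# Cell abc-stewartyu, WP-Y3 (vii): the half step of the TWISTED descent inside `ℚ_p`
# (provider A: odd class modulus `G`, square roots in `ℚ_p`)

`Summits/ABC/StewartYu/PadicTwistHalfStep.lean` — cell `abc-stewartyu` (seat p2; crux
`YuNinetyThreeModFour` stmt-ABC-19249, line `twist-w80`), sequel to `PadicTwistMain.lean`.
Theorems only; no named fact.  TWIN of p3's `PadicCW77HalfStep.lean` for `S : TwistSetup p`: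

* `Φ_half` — for `J < J₀`, ON A CLASS (`cls u = ρ` on the support of the coefficients),
  `φ_{J,τ}(s/2) = (ρˢ)^{(G+1)/2} · 2^{τ₀} · evL sq (classVec_{J,τ,s})` in `ℚ_p`, where
  `sqᵢ ∈ ℚ_p`, `sqᵢ² = allᵢ` are the square roots of `PadicTwistValues` [Yu 1990, (2.92)–(2.95);
  here no `ξ ∉ ℚ_p` appears because `G` is odd]; hence `‖φ_{J,τ}(s/2)‖ = ‖evL sq (classVec)‖`;
* `classVec_eq_zero_of_norm_Φ_half_lt` — p3's sign-free Liouville inequality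
  (`SetupQ.classVec_eq_zero_of_padicNorm_lt` with the roots `sqᵢ`) kills all class sums;
* `descent_class` — p3's `SetupQ.descent_algebra` WITH THE CLASS: re-indexing the residue class
  `(ε, ε_θ)` of a non-zero coefficient by `λ = ε + 2λ'` carries the class value `ρ` of level `J` to
  `ρ' = (ρ · cls₀(ε)⁻¹)^{(G+1)/2}` at level `J+1` (`cls(ε + 2λ') = cls₀(ε) · cls(λ')²`, square roots
  are unique inside `μ_G`) [Yu 1990, (2.101)–(2.106)];
* `inv_succ_of_norm_Φ_half_lt` — the classed invariant passes from `J` to `J+1` given the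
  `p`-adic smallness at the half points.

## References
* [Yu1990] K. Yu, *Linear forms in p-adic logarithms II*, Compositio Math. 74 (1990), §2.4
  (Lemmas 2.4, 2.5).
* [Waldschmidt1980] M. Waldschmidt, Acta Arith. 37 (1980), Lemma 3.7.
-/

noncomputable section

open NormedSpace Finset Polynomial
open Literature.NumberTheory.Transcendental
open Literature.NumberTheory.Transcendental.CW77 (heightProd sum_mul_prod_pow_eq_zero_of_shift)
open Literature.NumberTheory.Transcendental.CW77.Setup (Idx Tau tauNorm scale Qw_zero_right)
open Literature.NumberTheory.Transcendental.Baker1975.Ch3 (Qw)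
open Literature.NumberTheory.Transcendental.PadicCW77.Setup (DwQ liouvilleBound_anti)

namespace Summit.ABC.StewartYu

namespace TwistSetup

variable {p : ℕ} [Fact p.Prime] (S : TwistSetup p) {h Lb : ℕ}

/-! ### The `Δ`-factor at the half points -/

/-! ### The values of `φ_{J,τ}` at the half points, on a class -/

/-- One term: `termΦ(s/2) = ((cls u)ˢ)^{(G+1)/2} · 2^{τ₀} · (qΔ_{J+1} qA)(u) · ∏ᵢ sqᵢ^{expnᵢ(u,s)}`
(`J < J₀`). [folklore] -/
theorem termΦ_half (hodd : Odd S.G) {J₀ J : ℕ} (hJ : J < J₀) (u : Idx S.d h Lb) (τ : Tau S.d) (s : ℕ) :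
    S.termΦ J₀ J u τ ((2 : ℚ_[p])⁻¹ * (s : ℚ_[p])) =
      (S.cls u ^ s) ^ ((S.G + 1) / 2) *
        ((2 : ℚ_[p]) ^ τ.1 * ((S.frame.qΔ J₀ (J + 1) u τ.1 s * S.frame.qA u τ.2 : ℚ) : ℚ_[p]) *
          ∏ i : Fin (S.d + 1), S.sq i ^ S.frame.expn u s i) := by
  unfold termΦ
  rw [S.Dw_half hJ, S.A_eq, S.exp_ψ_half_natCast hodd]
  push_cast; ring

/-- **On a class, `φ_{J,τ}(s/2) = (ρˢ)^{(G+1)/2} · 2^{τ₀} · evL sq (classVec_{J,τ,s})`** (`J < J₀`):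
the value at a half point is, up to a root of unity, the evaluation of p3's SIGNED class-sum vector on
the monomials in the square roots `sqᵢ ∈ ℚ_p` of the rational generators. [folklore] -/
theorem Φ_half (hodd : Odd S.G) {J₀ J : ℕ} (hJ : J < J₀) (box : Finset (Idx S.d h Lb)) (pv : Idx S.d h Lb → ℤ)
    (τ : Tau S.d) (s : ℕ) {ρ : ℚ_[p]} (hcls : ∀ u ∈ box, pv u ≠ 0 → S.cls u = ρ) :
    S.Φ J₀ J box pv τ ((2 : ℚ_[p])⁻¹ * (s : ℚ_[p])) =
      (ρ ^ s) ^ ((S.G + 1) / 2) * ((2 : ℚ_[p]) ^ τ.1 *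
        Multiquad.evL S.sq (S.toQ.classVec J₀ J box pv τ s)) := by
  rw [← S.toQ.sum_half_eq_evL_classVec _ (S.sq_mul_self hodd) J₀ J box pv τ s]
  unfold Φ
  rw [mul_sum, mul_sum]
  refine sum_congr rfl fun u hu => ?_
  by_cases h0 : pv u = 0
  · rw [h0]; simp
  · rw [S.termΦ_half hodd hJ, hcls u hu h0]
    ring

/-- `‖2^{τ₀}‖_p = 1` (`p` odd). [folklore] -/
theorem norm_two_pow (S : TwistSetup p) (τ₀ : ℕ) : ‖(2 : ℚ_[p]) ^ τ₀‖ = 1 := by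
  rw [norm_pow, PadicExp.norm_two_eq_one S.hp3, one_pow]

/-- **`‖φ_{J,τ}(s/2)‖_p = ‖evL sq (classVec_{J,τ,s})‖_p` on a class** (`J < J₀`, `ρ^G = 1`).
[folklore] -/
theorem norm_Φ_half (hodd : Odd S.G) {J₀ J : ℕ} (hJ : J < J₀) (box : Finset (Idx S.d h Lb)) (pv : Idx S.d h Lb → ℤ)
    (τ : Tau S.d) (s : ℕ) {ρ : ℚ_[p]} (hcls : ∀ u ∈ box, pv u ≠ 0 → S.cls u = ρ) (hρ : ρ ^ S.G = 1) :
    ‖S.Φ J₀ J box pv τ ((2 : ℚ_[p])⁻¹ * (s : ℚ_[p]))‖ =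
      ‖Multiquad.evL S.sq (S.toQ.classVec J₀ J box pv τ s)‖ := by
  have hn : ‖ρ‖ = 1 := by
    have h := congrArg (‖·‖) hρ
    simp only [norm_pow, norm_one] at h
    exact (pow_eq_one_iff_of_nonneg (norm_nonneg _) S.hG.ne').mp h
  rw [S.Φ_half hodd hJ box pv τ s hcls, norm_mul, norm_mul, norm_pow, norm_pow, hn, one_pow, one_pow,
    one_mul, S.norm_two_pow, one_mul]

/-! ### The Liouville step at the half points -/

/-- **Vanishing of the class sums from `p`-adic smallness at a half point** (`J < J₀`), on a class:
under the `2`-Kummer condition on the signed generators, if `∑_{T'} |classVec_{J,τ,s}(T')| ≤ M`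
(`M ≥ 1`) and `‖φ_{J,τ}(s/2)‖_p < Dhalf♭/(4 Dhalf♭² M (∏ᵢ H(allᵢ))³)^{2^{d+1}}`, then
`classVec_{J,τ,s} = 0` (p3's `SetupQ.classVec_eq_zero_of_padicNorm_lt` with the roots `sqᵢ`).
[folklore] -/
theorem classVec_eq_zero_of_norm_Φ_half_lt (hodd : Odd S.G) {J₀ J : ℕ} (hJ : J < J₀)
    (hind : ∀ T' : Finset (Fin (S.d + 1)), T'.Nonempty → ¬ IsSquare (∏ i ∈ T', S.toQ.all i))
    (L : Fin S.d → ℕ) (Lθ : ℕ) (pv : Idx S.d h Lb → ℤ) {ρ : ℚ_[p]}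
    (hcls : ∀ u ∈ S.toQ.flat.box (h := h) (Lb := Lb) L Lθ J, pv u ≠ 0 → S.cls u = ρ) (hρ : ρ ^ S.G = 1)
    (τ : Tau S.d) (s : ℕ) {M : ℝ} (hM : 1 ≤ M)
    (hcM : ∑ T', |(S.toQ.classVec J₀ J (S.toQ.flat.box (h := h) (Lb := Lb) L Lθ J) pv τ s T' : ℝ)| ≤ M)
    (hlt : ‖S.Φ J₀ J (S.toQ.flat.box (h := h) (Lb := Lb) L Lθ J) pv τ ((2 : ℚ_[p])⁻¹ * (s : ℚ_[p]))‖ <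
      (S.toQ.flat.Dhalf (h := h) J₀ J L Lθ s τ : ℝ) /
        (4 * (S.toQ.flat.Dhalf (h := h) J₀ J L Lθ s τ : ℝ) ^ 2 * M * heightProd S.toQ.all ^ 3) ^
          (2 ^ (S.d + 1))) :
    S.toQ.classVec J₀ J (S.toQ.flat.box (h := h) (Lb := Lb) L Lθ J) pv τ s = 0 := by
  rw [S.norm_Φ_half hodd hJ _ pv τ s hcls hρ] at hlt
  exact S.toQ.classVec_eq_zero_of_padicNorm_lt hind S.sq (S.sq_mul_self hodd) S.norm_sq_le J₀ J L Lθ pv τ s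
    hM hcM hlt

/-! ### The descent with the class -/

/-- **The algebraic half of the descent, WITH THE CLASS** (p3's `SetupQ.descent_algebra` plus the
class update): from the classed invariant at level `J` and the vanishing of all class sums
`classVec_{J,τ,s}` (`s` odd `< 2^{J+1} S₀`, `|τ| < T/2^{J+1}`), the classed invariant at level
`J + 1`.  The new coefficient vector is `p'(v) = p(ε + 2v)` for the residues `(ε, ε_θ)` of a
non-zero coefficient, so `cls(v)² = ρ · cls₀(ε)⁻¹` on its support and the new class value is the
square root of that inside `μ_G`. [cite: Yu1990, §2.4 Lemma 2.5, (2.101)–(2.106)] -/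
theorem descent_class (hodd : Odd S.G) {J₀ J : ℕ} {L : Fin S.d → ℕ} {Lθ S₀ T : ℕ} {P : ℤ}
    {pv : Idx S.d h Lb → ℤ} (inv : S.Inv J₀ L Lθ S₀ T P J pv)
    (half : ∀ s, s < 2 ^ (J + 1) * S₀ → Odd s → ∀ τ : Tau S.d, tauNorm τ < T / 2 ^ (J + 1) →
      S.toQ.classVec J₀ J (S.toQ.flat.box (h := h) (Lb := Lb) L Lθ J) pv τ s = 0) :
    ∃ pv' : Idx S.d h Lb → ℤ, S.Inv J₀ L Lθ S₀ T P (J + 1) pv' := by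
  classical
  obtain ⟨u₀, hu₀⟩ := inv.inv.nonzero
  obtain ⟨ρ, hρG, hcls⟩ := inv.cls
  set ε : Fin S.d → ℕ := fun j => u₀.2.1 j % 2 with hεdef
  set εθ : ℕ := u₀.2.2 % 2 with hεθdef
  have hε : ∀ j, ε j ≤ 1 := fun j => by simp only [hεdef]; omega
  have hεθ : εθ ≤ 1 := by simp only [hεθdef]; omega
  set pv' : Idx S.d h Lb → ℤ := fun v => pv (S.toQ.flat.reidx ε εθ v) with hpv'
  set boxJ := S.toQ.flat.box (h := h) (Lb := Lb) L Lθ J with hboxJ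
  set boxJ1 := S.toQ.flat.box (h := h) (Lb := Lb) L Lθ (J + 1) with hboxJ1
  -- the new class value
  set c₀ : ℚ_[p] := ∏ i, S.η i ^ S.frame.resVec ε εθ i with hc₀
  have hc₀G : c₀ ^ S.G = 1 := by
    rw [hc₀, ← prod_pow]
    exact prod_eq_one fun i _ => by rw [← pow_mul, mul_comm, pow_mul, S.hηG, one_pow]
  have hc₀ne : c₀ ≠ 0 := fun h0 => by
    have := hc₀G; rw [h0, zero_pow S.hG.ne'] at this; exact zero_ne_one this
  set σ : ℚ_[p] := ρ * c₀⁻¹ with hσ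
  have hσG : σ ^ S.G = 1 := by rw [hσ, mul_pow, inv_pow, hρG, hc₀G, inv_one, mul_one]
  set ρ' : ℚ_[p] := σ ^ ((S.G + 1) / 2) with hρ'
  have hρ'G : ρ' ^ S.G = 1 := by rw [hρ', ← pow_mul, mul_comm, pow_mul, hσG, one_pow]
  have hcls' : ∀ v, pv' v ≠ 0 → S.cls v = ρ' := by
    intro v hv
    have h1 : S.cls (S.toQ.flat.reidx ε εθ v) = ρ := hcls _ hv
    rw [S.cls_reidx] at h1
    -- `c₀ · (cls v)² = ρ`, so `(cls v)² = σ = ρ'²`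
    have h2 : S.cls v ^ 2 = ρ' ^ 2 := by
      rw [hρ', S.pow_half_succ_sq hodd hσG, hσ, ← h1, ← hc₀]
      field_simp
    exact S.eq_of_sq_eq_of_pow_G hodd (S.cls_pow_G v) hρ'G h2
  refine ⟨pv', ⟨⟨?_, ?_, ?_, ?_⟩, ⟨ρ', hρ'G, hcls'⟩⟩⟩
  · -- support
    intro v hv
    exact S.toQ.flat.mem_box_succ_of_reidx (inv.inv.supp _ hv)
  · -- not all zero
    refine ⟨S.toQ.flat.halve u₀, ?_⟩
    simp only [hpv']
    rw [S.toQ.flat.reidx_halve u₀ (fun j => rfl) rfl]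
    exact hu₀
  · -- bound
    intro v; exact inv.inv.bound _
  · -- the relations at level `J + 1` (p3's algebra, verbatim)
    intro s hs hso τ hτ
    have hcv : ∀ τ' : Fin S.d → ℕ, τ.1 + ∑ j, τ' j < T / 2 ^ (J + 1) →
        S.toQ.classVec J₀ J boxJ pv (τ.1, τ') s (S.toQ.flat.Tpat ε εθ) = 0 := by
      intro τ' hτ'
      have h0 := half s hs hso (τ.1, τ') (by unfold tauNorm; exact hτ')
      exact congrFun h0 _
    set Vs := boxJ1.filter fun v => S.toQ.flat.reidx ε εθ v ∈ boxJ with hVs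
    set W : Idx S.d h Lb → ℚ := fun v =>
      (pv' v : ℚ) * (S.toQ.flat.qΔ J₀ (J + 1) v τ.1 s * S.toQ.qE v s) with hW
    have hshift : ∀ τ' : Fin S.d → ℕ, ∑ j, τ' j < T / 2 ^ (J + 1) - τ.1 →
        ∑ v ∈ Vs, W v * ∏ j, (S.toQ.flat.γ v j + S.toQ.flat.cγ ε εθ j) ^ τ' j = 0 := by
      intro τ' hτ'
      have h1 := hcv τ' (by omega)
      unfold SetupQ.classVec at h1
      rw [S.toQ.flat.sum_class_eq_sum_reidx hso hε hεθ L Lθ J] at h1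
      simp_rw [S.toQ.rHalf_reidx] at h1
      have hK : (2 : ℚ) ^ (∑ j, τ' j) * S.toQ.Kfac ε εθ s ≠ 0 :=
        mul_ne_zero (pow_ne_zero _ two_ne_zero) (S.toQ.Kfac_ne ε εθ s)
      have h2 : ∑ v ∈ Vs, (pv (S.toQ.flat.reidx ε εθ v) : ℚ) *
          ((2 : ℚ) ^ (∑ j, τ' j) * S.toQ.Kfac ε εθ s * ((S.toQ.flat.qΔ J₀ (J + 1) v τ.1 s * S.toQ.qE v s) *
            ∏ j, (S.toQ.flat.γ v j + S.toQ.flat.cγ ε εθ j) ^ τ' j)) =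
          ((2 : ℚ) ^ (∑ j, τ' j) * S.toQ.Kfac ε εθ s) *
            ∑ v ∈ Vs, W v * ∏ j, (S.toQ.flat.γ v j + S.toQ.flat.cγ ε εθ j) ^ τ' j := by
        rw [mul_sum]
        refine sum_congr rfl fun v _ => ?_
        simp only [hW, hpv']; ring
      rw [h2] at h1
      exact (mul_eq_zero.mp h1).resolve_left hK
    have hrel := sum_mul_prod_pow_eq_zero_of_shift (d := S.d) Vs W (fun v j => S.toQ.flat.γ v j)
      (S.toQ.flat.cγ ε εθ) _ hshift τ.2
      (by unfold tauNorm at hτ; exact Nat.lt_sub_of_add_lt (by rw [add_comm]; exact hτ))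
    have hcore : S.toQ.coreSum J₀ (J + 1) boxJ1 pv' τ s =
        ∑ v ∈ Vs, W v * ∏ j, S.toQ.flat.γ v j ^ τ.2 j := by
      unfold SetupQ.coreSum
      rw [hVs, sum_filter]
      refine sum_congr rfl fun v hv => ?_
      by_cases hvb : S.toQ.flat.reidx ε εθ v ∈ boxJ
      · rw [if_pos hvb]
        unfold SetupQ.qTerm CW77.Setup.qA
        simp only [hW]; ring
      · rw [if_neg hvb]
        have : pv' v = 0 := by
          simp only [hpv']
          by_contra hne
          exact hvb (inv.inv.supp _ hne)
        rw [this]; simp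
    rw [hcore]; exact hrel

/-- **The half step of the twisted descent** (twin of p3's `inv_succ_of_norm_Φ_half_lt`): from the
classed invariant at level `J < J₀`, uniform bounds `Dhalf♭(s,τ) ≤ Dmax` and
`∑_{T'}|classVec_{J,τ,s}(T')| ≤ Mmax` for all odd `s < 2^{J+1} S₀`, `|τ| < T/2^{J+1}`, and the
`p`-adic smallness `‖φ_{J,τ}(s/2)‖_p < Dmax/(4 Dmax² Mmax (∏ᵢ H(allᵢ))³)^{2^{d+1}}` at those points,
the classed invariant holds at level `J + 1`. [folklore] -/
theorem inv_succ_of_norm_Φ_half_lt (hodd : Odd S.G) {J₀ J : ℕ} (hJ : J < J₀)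
    (hind : ∀ T' : Finset (Fin (S.d + 1)), T'.Nonempty → ¬ IsSquare (∏ i ∈ T', S.toQ.all i))
    {L : Fin S.d → ℕ} {Lθ S₀ T : ℕ} {P : ℤ} {pv : Idx S.d h Lb → ℤ}
    (inv : S.Inv J₀ L Lθ S₀ T P J pv) {Dmax Mmax : ℝ} (hMmax : 1 ≤ Mmax)
    (hD : ∀ s, s < 2 ^ (J + 1) * S₀ → Odd s → ∀ τ : Tau S.d, tauNorm τ < T / 2 ^ (J + 1) →
      ((S.toQ.flat.Dhalf (h := h) J₀ J L Lθ s τ : ℕ) : ℝ) ≤ Dmax)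
    (hM : ∀ s, s < 2 ^ (J + 1) * S₀ → Odd s → ∀ τ : Tau S.d, tauNorm τ < T / 2 ^ (J + 1) →
      ∑ T', |(S.toQ.classVec J₀ J (S.toQ.flat.box (h := h) (Lb := Lb) L Lθ J) pv τ s T' : ℝ)| ≤ Mmax)
    (hsmall : ∀ s, s < 2 ^ (J + 1) * S₀ → Odd s → ∀ τ : Tau S.d, tauNorm τ < T / 2 ^ (J + 1) →
      ‖S.Φ J₀ J (S.toQ.flat.box (h := h) (Lb := Lb) L Lθ J) pv τ ((2 : ℚ_[p])⁻¹ * (s : ℚ_[p]))‖ <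
        Dmax / (4 * Dmax ^ 2 * Mmax * heightProd S.toQ.all ^ 3) ^ (2 ^ (S.d + 1))) :
    ∃ pv' : Idx S.d h Lb → ℤ, S.Inv J₀ L Lθ S₀ T P (J + 1) pv' := by
  obtain ⟨ρ, hρG, hcls⟩ := inv.cls
  refine S.descent_class hodd inv fun s hs hso τ hτ => ?_
  have hD1 : (1 : ℝ) ≤ (S.toQ.flat.Dhalf (h := h) J₀ J L Lθ s τ : ℕ) := by
    exact_mod_cast S.toQ.flat.Dhalf_pos J₀ J L Lθ s τ
  have hP : 0 < heightProd S.toQ.all := lt_of_lt_of_le one_pos (CW77.one_le_heightProd _)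
  have hE : 1 ≤ 2 ^ (S.d + 1) := Nat.one_le_two_pow
  have hmono := liouvilleBound_anti hE hD1 (hD s hs hso τ hτ) hMmax le_rfl hP
  refine S.classVec_eq_zero_of_norm_Φ_half_lt hodd hJ hind L Lθ pv (fun u _ hu => hcls u hu) hρG τ s hMmax
    (hM s hs hso τ hτ) ?_
  exact lt_of_lt_of_le (hsmall s hs hso τ hτ) hmono

end TwistSetup

end Summit.ABC.StewartYu

end
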